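import Summits.BirchSwinnertonDyer.BirchSwinnertonDyer.Theorems.BiquadraticEisensteinDescentHeegnerTwistCouplingInSupplySqrtTwoLadder
import Mathlib.Tactic.NormNum.LegendreSymbol
import HarnessLib

set_option linter.dupNamespace false -- `Summit.BirchSwinnertonDyer.BirchSwinnertonDyer.Theorems.…` (summit = sub)
set_option autoImplicit false

/-!
# Crux `HeegnerTwistCouplingInSupply` (stmt-BirchSwinnertonDyer-21381) — card `sqrt2-isogeny-heegner-pin`: the CELL-5 ladder on the
# `j = 8000` corner `W = B_p`, `p ≡ 5 (mod 8)`, BELOW the size thresholds — the row rung (Cohen's pair counter) and the five rows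
# `p = 5, 29, 61, 101, 181`

Route `BiquadraticEisensteinDescent` (cell `pub/bsd-wall`, width seat `bsd-wall-cm-bed-w1` g10; `--supports` 21381, helper). Sequel of
`…SqrtTwoLadder` (generic rung with the size lever `c = q₀`; rungs `13/29/37/53/61` above `P = 61/231/346/629/795`; T_A = partner `5`).
A script over the primes `p ≡ 5 (mod 8)`, `p < 3000` (seat folder, `gap.py`) finds exactly FIVE primes covered neither by T_A nor by a
rung above its threshold: `p ∈ {5, 29, 61, 101, 181}` (and none with all of `5, 13, 29, 37, 53, 61` residues). Each has an explicit pin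
`ℓ ≡ 3 (mod 8)`, `(ℓ/p) = −1`, and partner `q₀ ≡ 5 (mod 8)`, `(q₀/p) = −1`, with `h(−ℓq₀) < p` certified by the tree's kernel value
`BinQF.classNumberCount` (Cohen's Algorithm 5.3.5, `classNumber_lt_of_count`):
`(5; 3, 13; h(−39) = 4)`, `(29; 3, 37; h(−111) = 8)`, `(61; 11, 53; h(−583) = 8)`, `(101; 3, 29; h(−87) = 6)`, `(181; 19, 61; h(−1159) = 16)`.

* §1 ★ `cruxOnBpCornerRow_of_two_facts` — the ROW rung: explicit primes `ℓ ≡ 3`, `q₀ ≡ 5 (mod 8)` with `(ℓ/p) = (q₀/p) = −1` and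
  `classNumberCount(ℓq₀) < p` ⇒ the crux CONCLUSION for `W = B_p` (`K′ = ℚ(√−ℓq₀)`, `m = p·ℓ·q₀ ∈` CELL-5), modulo Burungale–Tian +
  Deuring–Hecke;
* §2 the five rows (`jacobiSym` by `norm_num`, `classNumberCount` by `decide`).

HONEST FRAMING: five more primes of one CM family; the structural residual of the ladder (every partner a residue) is untouched; the crux
(all CM `W`; residual C⁺) and BSD are NOT proved by any of this. THEOREMS ONLY; supports stmt-BirchSwinnertonDyer-21381.
-/

noncomputable section

open scoped Classical

namespace Summit.BirchSwinnertonDyer.BirchSwinnertonDyer.Theorems.BiquadraticEisensteinDescentHeegnerTwistCouplingInSupplySqrtTwoLadderRows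

open _root_.WeierstrassCurve Literature.NumberTheory.EllipticCurves Literature.NumberTheory.QuadraticFields.Quadratic
open Summit.BirchSwinnertonDyer.BirchSwinnertonDyer.Theorems.BiquadraticEisensteinDescentHeegnerTwistCouplingInSupplySqrtTwoCell
open Summit.BirchSwinnertonDyer.BirchSwinnertonDyer.Theorems.BiquadraticEisensteinDescentHeegnerTwistCouplingInSupplySqrtTwoCorner
open Summit.BirchSwinnertonDyer.BirchSwinnertonDyer.Theorems.BiquadraticEisensteinDescentHeegnerTwistCouplingInSupplySqrtTwoLadder
open Summit.BirchSwinnertonDyer.BirchSwinnertonDyer.Theorems.BiquadraticEisensteinDescentHeegnerTwistCouplingInSupplyPartnerLadder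

/-! ## §1 ★ The row rung -/

/-- ★ **Row rung, two named facts.** For primes `ℓ ≡ 3 (mod 8)`, `q₀ ≡ 5 (mod 8)` and a prime `p ≡ 5 (mod 8)` with `(ℓ/p) = (q₀/p) = −1`
and Cohen's count `h(−ℓq₀) = classNumberCount(ℓq₀) < p`: `K′ = ℚ(√−ℓq₀)` is Heegner for `N(B_p)` (`d ≡ 1 (mod 8)`, `(d/p) = +1`),
`4 < |d|`, `L(B_p^{(d)}, 1) ≠ 0` (`m = p·ℓ·q₀ ∈` CELL-5, `…SqrtTwoCell` + Burungale–Tian + Deuring–Hecke), `h(K′) < p`, `p ∤ h(K′)`.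
[cite: BurungaleTian2026, Thm. 1.1] [cite: SilvermanAEC2009, Prop. X.4.9 and Thm. X.4.2(a)] [cite: Cohen1993, §5.3.1 Algorithm 5.3.5] -/
theorem cruxOnBpCornerRow_of_two_facts (hBT : burungaleTian_analyticRank_eq_zero_of_selmerCorank_eq_zero_of_hasCM)
    (hH : hasEntireLFunction_of_j_mem_maximalCMJInvariants) {ℓ q₀ : ℕ} (hℓ : ℓ.Prime) (hℓ8 : ℓ % 8 = 3) (hq₀ : q₀.Prime)
    (hq₀8 : q₀ % 8 = 5) :
    ∀ (p : ℕ) [Fact p.Prime] [(⟨0, 4 * (p : ℚ), 0, 2 * (p : ℚ) ^ 2, 0⟩ : WeierstrassCurve ℚ).IsElliptic]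
      [(⟨0, 4 * (p : ℚ), 0, 2 * (p : ℚ) ^ 2, 0⟩ : WeierstrassCurve ℚ).IsGloballyMinimal]
      [NeZero ((⟨0, 4 * (p : ℚ), 0, 2 * (p : ℚ) ^ 2, 0⟩ : WeierstrassCurve ℚ).conductorNorm ℤ)],
      p % 8 = 5 → jacobiSym (ℓ : ℤ) p = -1 → jacobiSym (q₀ : ℤ) p = -1 → BinQF.classNumberCount (ℓ * q₀) < p →
      ∃ (K : Type) (_ : Field K) (_ : NumberField K),
        IsImaginaryQuadratic K ∧ 4 < (NumberField.discr K).natAbs ∧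
        SatisfiesHeegnerHypothesis ((⟨0, 4 * (p : ℚ), 0, 2 * (p : ℚ) ^ 2, 0⟩ : WeierstrassCurve ℚ).conductorNorm ℤ) K ∧
        ((⟨0, 4 * (p : ℚ), 0, 2 * (p : ℚ) ^ 2, 0⟩ : WeierstrassCurve ℚ).quadraticTwist (NumberField.discr K : ℚ)).entireLFunction 1 ≠ 0 ∧
        NumberField.classNumber K < p ∧ ¬ p ∣ NumberField.classNumber K := by
  intro p hpF _ _ _ hp8 hJℓ hJq hh
  have hp : p.Prime := hpF.out
  have hJ : jacobiSym (-((ℓ * q₀ : ℕ) : ℤ)) p = 1 := jacobiSym_neg_mul_eq_one_of_mod_four_eq_one (by omega) hJℓ hJq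
  obtain ⟨K, iF, iN, hK, hdK, hH', hcl⟩ := exists_witnessField_of
    (N := (⟨0, 4 * (p : ℚ), 0, 2 * (p : ℚ) ^ 2, 0⟩ : WeierstrassCurve ℚ).conductorNorm ℤ) hℓ hℓ8 hq₀ hq₀8 hJ
    (classNumber_lt_of_count hℓ hq₀ hh) (fun r hr hrN => eq_two_or_eq_of_prime_dvd_conductorNorm_B hp hr hrN)
  refine ⟨K, iF, iN, hK, ?_, hH', ?_, hcl, fun hdvd =>
    absurd (Nat.le_of_dvd (NumberField.classNumber_pos K) hdvd) (not_le.mpr hcl)⟩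
  · rw [hdK, Int.natAbs_neg, Int.natAbs_natCast]
    have h3 : 3 ≤ ℓ := by have := hℓ.two_le; omega
    have h5 : 5 ≤ q₀ := by have := hq₀.two_le; omega
    nlinarith
  · rw [hdK, quadraticTwist_B_neg_mul]
    have hℓq : ℓ ≠ q₀ := by rintro rfl; omega
    obtain ⟨hsq, hfac⟩ := squarefree_mul_mul_of_primes hp hℓ hq₀ (ne_of_jacobiSym_eq_neg_one hp hJℓ).symm
      (ne_of_jacobiSym_eq_neg_one hp hJq).symm hℓq
    have hm0 : (0 : ℤ) < ((p * ℓ * q₀ : ℕ) : ℤ) := by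
      have := hp.pos
      have := hℓ.pos
      have := hq₀.pos
      positivity
    have hm8 : ∀ r : ℕ, r.Prime → (r : ℤ) ∣ ((p * ℓ * q₀ : ℕ) : ℤ) → r % 8 = 3 ∨ r % 8 = 5 := by
      intro r hr hrd
      rcases hfac r hr (by exact_mod_cast hrd) with rfl | rfl | rfl <;> omega
    haveI := isElliptic_B hm0.ne'
    exact (L_one_ne_zero_B_neg hBT hH hm0 (Int.squarefree_natCast.mpr hsq) hm8).2

/-! ## §2 The five rows `p = 5, 29, 61, 101, 181` -/

/-- Row data `(p; ℓ, q₀) = (5; 3, 13)`: `(3/5) = (13/5) = −1`, `h(−39) = 4 < 5`. [cite: Cohen1993, §5.3.1 Algorithm 5.3.5] -/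
theorem row_five : jacobiSym (3 : ℤ) 5 = -1 ∧ jacobiSym (13 : ℤ) 5 = -1 ∧ BinQF.classNumberCount (3 * 13) < 5 :=
  ⟨by norm_num, by norm_num, by decide +kernel⟩

/-- Row data `(29; 3, 37)`: `(3/29) = (37/29) = −1`, `h(−111) = 8 < 29`. [cite: Cohen1993, §5.3.1 Algorithm 5.3.5] -/
theorem row_twentyNine : jacobiSym (3 : ℤ) 29 = -1 ∧ jacobiSym (37 : ℤ) 29 = -1 ∧ BinQF.classNumberCount (3 * 37) < 29 :=
  ⟨by norm_num, by norm_num, by decide +kernel⟩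

/-- Row data `(61; 11, 53)`: `(11/61) = (53/61) = −1`, `h(−583) = 8 < 61`. [cite: Cohen1993, §5.3.1 Algorithm 5.3.5] -/
theorem row_sixtyOne : jacobiSym (11 : ℤ) 61 = -1 ∧ jacobiSym (53 : ℤ) 61 = -1 ∧ BinQF.classNumberCount (11 * 53) < 61 :=
  ⟨by norm_num, by norm_num, by decide +kernel⟩

/-- Row data `(101; 3, 29)`: `(3/101) = (29/101) = −1`, `h(−87) = 6 < 101`. [cite: Cohen1993, §5.3.1 Algorithm 5.3.5] -/
theorem row_oneHundredOne : jacobiSym (3 : ℤ) 101 = -1 ∧ jacobiSym (29 : ℤ) 101 = -1 ∧ BinQF.classNumberCount (3 * 29) < 101 :=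
  ⟨by norm_num, by norm_num, by decide +kernel⟩

/-- Row data `(181; 19, 61)`: `(19/181) = (61/181) = −1`, `h(−1159) = 16 < 181`. [cite: Cohen1993, §5.3.1 Algorithm 5.3.5] -/
theorem row_oneHundredEightyOne :
    jacobiSym (19 : ℤ) 181 = -1 ∧ jacobiSym (61 : ℤ) 181 = -1 ∧ BinQF.classNumberCount (19 * 61) < 181 :=
  ⟨by norm_num, by norm_num, by decide +kernel⟩

/-- ★★ **The five rows**: for `p ∈ {5, 29, 61, 101, 181}` and `W = B_p`, the CONCLUSION of crux 21381 modulo Burungale–Tian +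
Deuring–Hecke (these are the only primes `p ≡ 5 (mod 8)` below `3000` outside T_A ∪ the thresholded ladder of `…SqrtTwoLadder`).
[cite: BurungaleTian2026, Thm. 1.1] [cite: Cohen1993, §5.3.1 Algorithm 5.3.5] -/
theorem cruxOnBpCornerRows_of_two_facts (hBT : burungaleTian_analyticRank_eq_zero_of_selmerCorank_eq_zero_of_hasCM)
    (hH : hasEntireLFunction_of_j_mem_maximalCMJInvariants) :
    ∀ (p : ℕ) [Fact p.Prime] [(⟨0, 4 * (p : ℚ), 0, 2 * (p : ℚ) ^ 2, 0⟩ : WeierstrassCurve ℚ).IsElliptic]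
      [(⟨0, 4 * (p : ℚ), 0, 2 * (p : ℚ) ^ 2, 0⟩ : WeierstrassCurve ℚ).IsGloballyMinimal]
      [NeZero ((⟨0, 4 * (p : ℚ), 0, 2 * (p : ℚ) ^ 2, 0⟩ : WeierstrassCurve ℚ).conductorNorm ℤ)],
      (p = 5 ∨ p = 29 ∨ p = 61 ∨ p = 101 ∨ p = 181) →
      ∃ (K : Type) (_ : Field K) (_ : NumberField K),
        IsImaginaryQuadratic K ∧ 4 < (NumberField.discr K).natAbs ∧
        SatisfiesHeegnerHypothesis ((⟨0, 4 * (p : ℚ), 0, 2 * (p : ℚ) ^ 2, 0⟩ : WeierstrassCurve ℚ).conductorNorm ℤ) K ∧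
        ((⟨0, 4 * (p : ℚ), 0, 2 * (p : ℚ) ^ 2, 0⟩ : WeierstrassCurve ℚ).quadraticTwist (NumberField.discr K : ℚ)).entireLFunction 1 ≠ 0 ∧
        NumberField.classNumber K < p ∧ ¬ p ∣ NumberField.classNumber K := by
  intro p hpF _ _ _ hcase
  rcases hcase with rfl | rfl | rfl | rfl | rfl
  · obtain ⟨h1, h2, h3⟩ := row_five
    exact cruxOnBpCornerRow_of_two_facts hBT hH Nat.prime_three (by norm_num) (by norm_num) (by norm_num) 5 (by norm_num) h1 h2 h3
  · obtain ⟨h1, h2, h3⟩ := row_twentyNine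
    exact cruxOnBpCornerRow_of_two_facts hBT hH Nat.prime_three (by norm_num) (by norm_num) (by norm_num) 29 (by norm_num) h1 h2 h3
  · obtain ⟨h1, h2, h3⟩ := row_sixtyOne
    exact cruxOnBpCornerRow_of_two_facts hBT hH (by norm_num) (by norm_num) (by norm_num) (by norm_num) 61 (by norm_num) h1 h2 h3
  · obtain ⟨h1, h2, h3⟩ := row_oneHundredOne
    exact cruxOnBpCornerRow_of_two_facts hBT hH Nat.prime_three (by norm_num) (by norm_num) (by norm_num) 101 (by norm_num) h1 h2 h3
  · obtain ⟨h1, h2, h3⟩ := row_oneHundredEightyOne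
    exact cruxOnBpCornerRow_of_two_facts hBT hH (by norm_num) (by norm_num) (by norm_num) (by norm_num) 181 (by norm_num) h1 h2 h3

end Summit.BirchSwinnertonDyer.BirchSwinnertonDyer.Theorems.BiquadraticEisensteinDescentHeegnerTwistCouplingInSupplySqrtTwoLadderRows

end
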